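import Literature.Geometry.Manifold.BreathingDeformation
import Mathlib.Analysis.Calculus.InverseFunctionTheorem.ApproximatesLinearOn
import Mathlib.Analysis.Calculus.ContDiff.Operations
import Mathlib.Analysis.Calculus.MeanValue
import Mathlib.Analysis.SpecificLimits.Normed
import HarnessLib

/-!
# Breathing deformations are diffeomorphisms for small parameters

Sequel to `BreathingDeformation.lean` (topic `Geometry/Manifold`; explicit construction plus
proofs). For the breathing deformation `φ s z = z + s • g z` of a finite-dimensional inner product
space `F` (`g = gField z₀ r` smooth, supported in the closed ball `closedBall z₀ r`, with globally
bounded differential `‖dg‖ ≤ B`), and `|s| < invScale = (2(B+1))⁻¹`: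

* `approximatesLinearOn_phi` — `φ s` is a `½`-Lipschitz perturbation of the identity
  (`‖(φ x − φ y) − (x − y)‖ ≤ ½ ‖x − y‖`, mean value theorem), hence
* `phiHomeomorph` — **`φ s` is a homeomorphism of `F`** (Mathlib's inverse function theorem in the
  global form `ApproximatesLinearOn.toHomeomorph`), `coe_phiHomeomorph : ⇑(phiHomeomorph …) = φ s`;
* `contDiff_phiHomeomorph_symm` — **its inverse is smooth** (`Homeomorph.contDiff_symm`: the
  differentials `dφ = 1 + s dg`, `‖s dg‖ < 1`, are units of the Banach algebra `F →L F`);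
* `phiHomeomorph_symm_eq_self` — the inverse fixes every point fixed by `φ s`, in particular it is
  the identity off the ball `ball z₀ r` (`phiHomeomorph_symm_eq_self_of_not_mem_ball`) and maps the
  ball into itself (`phiHomeomorph_symm_mem_ball`).

This is the standard fact that a `C¹`-small compactly supported perturbation of the identity is a
diffeomorphism (Lee, *Introduction to Smooth Manifolds*, 2nd ed., proof of Thm. 9.25 / flows of
compactly supported vector fields; here via the contraction form of the inverse function theorem).

## References

* J. M. Lee, *Introduction to Smooth Manifolds*, 2nd ed. (2013), Ch. 9. [LeeSmoothManifolds2013]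
-/

noncomputable section

open Set Metric Filter Function NNReal
open scoped Topology ContDiff

namespace Literature.Geometry.Manifold.Breathing

variable {F : Type*} [NormedAddCommGroup F] [InnerProductSpace ℝ F] [FiniteDimensional ℝ F]
  (z₀ : F) {r : ℝ} (hr : 0 < r)

/-! ### The threshold -/

/-- A global bound `B ≥ 0` of `‖dg‖` (a choice from `exists_bound_fderiv_gField`). [folklore] -/
def derivBound (z₀ : F) {r : ℝ} (hr : 0 < r) : ℝ :=
  Classical.choose (exists_bound_fderiv_gField z₀ r hr)

/-- The defining properties of `derivBound`. [folklore] -/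
theorem derivBound_spec : 0 ≤ derivBound z₀ hr ∧ ∀ z : F, ‖fderiv ℝ (gField z₀ r) z‖ ≤ derivBound z₀ hr :=
  Classical.choose_spec (exists_bound_fderiv_gField z₀ r hr)

/-- **The invertibility threshold** `(2(B + 1))⁻¹`: for `|s|` below it, `‖s dg‖ ≤ ½ · B/(B+1) < ½`. [folklore] -/
def invScale (z₀ : F) {r : ℝ} (hr : 0 < r) : ℝ := (2 * (derivBound z₀ hr + 1))⁻¹

/-- The threshold is positive. [folklore] -/
theorem invScale_pos : 0 < invScale z₀ hr := by
  have h := (derivBound_spec z₀ hr).1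
  unfold invScale
  positivity

/-- The threshold is at most `½`. [folklore] -/
theorem invScale_le_half : invScale z₀ hr ≤ 1 / 2 := by
  have h := (derivBound_spec z₀ hr).1
  unfold invScale
  rw [one_div]
  exact inv_anti₀ (by norm_num) (by linarith)

variable {z₀ hr}

/-- Below the threshold, `|s| B ≤ ½` (indeed `< ½`). [folklore] -/
theorem abs_mul_derivBound_le {s : ℝ} (hs : |s| < invScale z₀ hr) : |s| * derivBound z₀ hr ≤ 1 / 2 := by
  obtain ⟨hB, -⟩ := derivBound_spec z₀ hr
  have h1 : |s| * derivBound z₀ hr ≤ invScale z₀ hr * (derivBound z₀ hr + 1) :=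
    mul_le_mul hs.le (by linarith) hB (invScale_pos z₀ hr).le
  have h2 : invScale z₀ hr * (derivBound z₀ hr + 1) = 1 / 2 := by
    unfold invScale
    field_simp
  linarith

/-- Below the threshold, `‖s • dg(z)‖ < 1`. [folklore] -/
theorem norm_smul_fderiv_gField_lt_one {s : ℝ} (hs : |s| < invScale z₀ hr) (z : F) :
    ‖s • fderiv ℝ (gField z₀ r) z‖ < 1 := by
  rw [norm_smul, Real.norm_eq_abs]
  have h := mul_le_mul_of_nonneg_left ((derivBound_spec z₀ hr).2 z) (abs_nonneg s)
  linarith [abs_mul_derivBound_le hs]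

/-! ### `φ s` approximates the identity -/

/-- **`φ s` is a `½`-Lipschitz perturbation of the identity** for `|s| < invScale`:
`‖(φ x − φ y) − (x − y)‖ = |s| ‖g x − g y‖ ≤ |s| B ‖x − y‖ ≤ ½ ‖x − y‖` (mean value theorem for
`g`). [cite: LeeSmoothManifolds2013, Ch. 9] -/
theorem approximatesLinearOn_phi {s : ℝ} (hs : |s| < invScale z₀ hr) :
    ApproximatesLinearOn (phi z₀ r s) ((ContinuousLinearEquiv.refl ℝ F : F ≃L[ℝ] F) : F →L[ℝ] F) univ
      ((1 : ℝ≥0) / 2) := by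
  intro x _ y _
  have hg : ∀ z ∈ (univ : Set F), DifferentiableAt ℝ (gField z₀ r) z := fun z _ ↦
    (contDiff_gField z₀ r (n := 1)).differentiable one_ne_zero z
  have hmv := Convex.norm_image_sub_le_of_norm_fderiv_le hg
    (fun z _ ↦ (derivBound_spec z₀ hr).2 z) convex_univ (mem_univ y) (mem_univ x)
  have hid : ((ContinuousLinearEquiv.refl ℝ F : F ≃L[ℝ] F) : F →L[ℝ] F) (x - y) = x - y := rfl
  have heq : phi z₀ r s x - phi z₀ r s y -
      ((ContinuousLinearEquiv.refl ℝ F : F ≃L[ℝ] F) : F →L[ℝ] F) (x - y) =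
      s • (gField z₀ r x - gField z₀ r y) := by
    rw [hid]
    simp only [phi, smul_sub]
    abel
  rw [heq, norm_smul, Real.norm_eq_abs]
  have hB : |s| * ‖gField z₀ r x - gField z₀ r y‖ ≤ |s| * (derivBound z₀ hr * ‖x - y‖) :=
    mul_le_mul_of_nonneg_left hmv (abs_nonneg s)
  have hsB := abs_mul_derivBound_le hs
  have hxy := norm_nonneg (x - y)
  calc |s| * ‖gField z₀ r x - gField z₀ r y‖ ≤ |s| * derivBound z₀ hr * ‖x - y‖ := by
        rw [mul_assoc]; exact hB
    _ ≤ 1 / 2 * ‖x - y‖ := mul_le_mul_of_nonneg_right hsB hxy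
    _ = ((1 : ℝ≥0) / 2 : ℝ≥0) * ‖x - y‖ := by norm_num

variable [Nontrivial F]

omit [FiniteDimensional ℝ F] in
/-- The constant `½` is below the inverse norm `‖id‖⁻¹ = 1` of the identity. [folklore] -/
theorem half_lt_inv_nnnorm_refl_symm :
    (1 : ℝ≥0) / 2 < ‖(((ContinuousLinearEquiv.refl ℝ F).symm : F ≃L[ℝ] F) : F →L[ℝ] F)‖₊⁻¹ := by
  have h : ‖(((ContinuousLinearEquiv.refl ℝ F).symm : F ≃L[ℝ] F) : F →L[ℝ] F)‖₊ = 1 := by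
    rw [ContinuousLinearEquiv.refl_symm, ContinuousLinearEquiv.coe_refl]
    exact Subtype.ext (by simp)
  rw [h, inv_one]
  exact NNReal.half_lt_self one_ne_zero

/-- **`φ s` is a homeomorphism of `F` for `|s| < invScale`** (the global contraction form of the
inverse function theorem, `ApproximatesLinearOn.toHomeomorph`). [cite: LeeSmoothManifolds2013, Ch. 9] -/
def phiHomeomorph {s : ℝ} (hs : |s| < invScale z₀ hr) : F ≃ₜ F :=
  (approximatesLinearOn_phi hs).toHomeomorph (phi z₀ r s) (Or.inr half_lt_inv_nnnorm_refl_symm)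

/-- The homeomorphism is `φ s` as a function. [folklore] -/
@[simp] theorem coe_phiHomeomorph {s : ℝ} (hs : |s| < invScale z₀ hr) :
    ⇑(phiHomeomorph hs) = phi z₀ r s := rfl

/-- The inverse is a right inverse of `φ s`: `φ s (φ⁻¹ w) = w`. [folklore] -/
theorem phi_phiHomeomorph_symm {s : ℝ} (hs : |s| < invScale z₀ hr) (w : F) :
    phi z₀ r s ((phiHomeomorph hs).symm w) = w := by
  rw [← coe_phiHomeomorph hs]
  exact (phiHomeomorph hs).apply_symm_apply w

/-- The inverse is a left inverse of `φ s`: `φ⁻¹ (φ s z) = z`. [folklore] -/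
theorem phiHomeomorph_symm_phi {s : ℝ} (hs : |s| < invScale z₀ hr) (z : F) :
    (phiHomeomorph hs).symm (phi z₀ r s z) = z := by
  rw [← coe_phiHomeomorph hs]
  exact (phiHomeomorph hs).symm_apply_apply z

/-! ### Smoothness of the inverse -/

/-- The differential of `φ s` at `z` as a unit of the Banach algebra `F →L F`: `1 − (−s dg(z))` with
`‖s dg(z)‖ < 1`. [folklore] -/
def fderivUnit {s : ℝ} (hs : |s| < invScale z₀ hr) (z : F) : (F →L[ℝ] F)ˣ :=
  Units.oneSub (-(s • fderiv ℝ (gField z₀ r) z)) (by rw [norm_neg]; exact norm_smul_fderiv_gField_lt_one hs z)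

omit [Nontrivial F] in
/-- The unit is the differential `dφ_s(z) = 1 + s dg(z)`. [folklore] -/
theorem coe_fderivUnit {s : ℝ} (hs : |s| < invScale z₀ hr) (z : F) :
    ((fderivUnit hs z : (F →L[ℝ] F)ˣ) : F →L[ℝ] F) = fderiv ℝ (phi z₀ r s) z := by
  rw [fderivUnit, Units.val_oneSub, fderiv_phi, sub_neg_eq_add]
  rfl

/-- `φ s` has the invertible differential `fderivUnit` at every point. [folklore] -/
theorem hasFDerivAt_phi_ofUnit {s : ℝ} (hs : |s| < invScale z₀ hr) (z : F) :
    HasFDerivAt (phiHomeomorph hs) ((ContinuousLinearEquiv.ofUnit (fderivUnit hs z) : F ≃L[ℝ] F) : F →L[ℝ] F) z := by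
  have hd : DifferentiableAt ℝ (phi z₀ r s) z := (contDiff_phi z₀ r s (n := 1)).differentiable one_ne_zero z
  have h := hd.hasFDerivAt
  rw [← coe_fderivUnit hs z] at h
  rw [coe_phiHomeomorph]
  exact h

/-- **The inverse of `φ s` is smooth** (`|s| < invScale`). [cite: LeeSmoothManifolds2013, Ch. 9] -/
theorem contDiff_phiHomeomorph_symm {s : ℝ} (hs : |s| < invScale z₀ hr) {n : ℕ∞} :
    ContDiff ℝ n ((phiHomeomorph hs).symm : F → F) := by
  haveI : CompleteSpace F := FiniteDimensional.complete ℝ F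
  refine (phiHomeomorph hs).contDiff_symm (fun z ↦ hasFDerivAt_phi_ofUnit hs z) ?_
  rw [coe_phiHomeomorph]
  exact contDiff_phi z₀ r s

/-! ### Where the inverse is the identity -/

/-- A point fixed by `φ s` is fixed by the inverse. [folklore] -/
theorem phiHomeomorph_symm_eq_self {s : ℝ} (hs : |s| < invScale z₀ hr) {w : F}
    (hw : phi z₀ r s w = w) : (phiHomeomorph hs).symm w = w := by
  conv_lhs => rw [← hw]
  exact phiHomeomorph_symm_phi hs w

/-- **The inverse is the identity off the ball `ball z₀ r`.** [cite: LeeSmoothManifolds2013, Ch. 9] -/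
theorem phiHomeomorph_symm_eq_self_of_not_mem_ball {s : ℝ} (hs : |s| < invScale z₀ hr) {w : F}
    (hw : w ∉ ball z₀ r) : (phiHomeomorph hs).symm w = w :=
  phiHomeomorph_symm_eq_self hs (phi_eq_self_of_not_mem_ball z₀ r hr hw s)

/-- The inverse is the identity wherever `r²/2 ≤ ‖w − z₀‖²` (outside the support of `g`). [folklore] -/
theorem phiHomeomorph_symm_eq_self_of {s : ℝ} (hs : |s| < invScale z₀ hr) {w : F}
    (hw : r ^ 2 / 2 ≤ ‖w - z₀‖ ^ 2) : (phiHomeomorph hs).symm w = w :=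
  phiHomeomorph_symm_eq_self hs (phi_eq_self_of z₀ r hr hw s)

/-- **The inverse maps the ball `ball z₀ r` into itself** (the ball and its complement are both
invariant under the bijection `φ s`, which is the identity on the complement). [cite: LeeSmoothManifolds2013, Ch. 9] -/
theorem phiHomeomorph_symm_mem_ball {s : ℝ} (hs : |s| < invScale z₀ hr) {w : F} (hw : w ∈ ball z₀ r) :
    (phiHomeomorph hs).symm w ∈ ball z₀ r := by
  by_contra h
  have hfix : phi z₀ r s ((phiHomeomorph hs).symm w) = (phiHomeomorph hs).symm w :=
    phi_eq_self_of_not_mem_ball z₀ r hr h s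
  rw [phi_phiHomeomorph_symm hs w] at hfix
  exact h (hfix ▸ hw)

/-- **The inverse preserves the support region `{‖w − z₀‖² < r²/2}` of `g`**: a point outside it is
fixed by `φ s`, hence by the inverse, so the inverse image of a point inside stays inside. [folklore] -/
theorem norm_sq_phiHomeomorph_symm_lt {s : ℝ} (hs : |s| < invScale z₀ hr) {w : F}
    (hw : ‖w - z₀‖ ^ 2 < r ^ 2 / 2) : ‖(phiHomeomorph hs).symm w - z₀‖ ^ 2 < r ^ 2 / 2 := by
  by_contra h
  rw [not_lt] at h
  have hfix : phi z₀ r s ((phiHomeomorph hs).symm w) = (phiHomeomorph hs).symm w :=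
    phi_eq_self_of z₀ r hr h s
  rw [phi_phiHomeomorph_symm hs w] at hfix
  rw [hfix] at hw
  exact (lt_irrefl _) (lt_of_lt_of_le hw h)

end Literature.Geometry.Manifold.Breathing

end
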